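import Mathlib
import Literature.NumberTheory.Transcendental.KZCalculus
import Summits.KontsevichZagierPeriods.KontsevichZagierPeriods.Theses.UnfoldedStokes

/-!
# `LegendreCubicForm` (stmt-KontsevichZagierPeriods-3521), line `Sketch` (hat-box chart) — SKELETON

Legendre's relation `η₂ω₁ − η₁ω₂ = 2πi` for `E : y² = P(x) = (x−e₁)(x−e₂)(x−e₃)`, `e₁ < e₂ < e₃` rational, in
single-curve interval form: `[(e₁,e₂)×(e₂,e₃), (μ−λ)/√(|P(λ)||P(μ)|)] ~ [ℝ, 2/(1+x²)]` in the Kontsevich–Zagier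
calculus. Chain (sphero-conal coordinates of `S²` + Archimedes' hat-box):

* M1 (rule 2) the hat-box map `Λ(λ,μ) = (u,z) = (√((e₃−e₁)(e₂−λ)(μ−e₂)/((e₃−e₂)(λ−e₁)(μ−e₁))),
  √((e₃−λ)(e₃−μ)/((e₃−e₁)(e₃−e₂))))` is a bijection of the open rectangle onto `(0,∞)×(0,1)` with
  `g = (4/(1+u²))∘Λ · |det DΛ|` — stubs `stub_hatBoxInjOn`, `stub_hatBoxImage`, `stub_hatBoxJacobian`,
  packaged by `stub_hatBoxTransfer`;
* M2 (rules 1, 3) height integration `[(0,∞)×(0,1), 4/(1+u²)] ~ [(0,∞), 4/(1+u²)]` — `stub_heightNewtonLeibniz`;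
* M3–M6 (rules 1, 2) the arctangent tail `[(0,∞), 4/(1+x²)] ~ [ℝ, 2/(1+x²)]` — `stub_arctanTail`.

`LegendreCubicForm_of` composes the six stubs and concludes the crux BY NAME. No definitions are introduced
(all objects are written out explicitly in the stub signatures). References: Kontsevich–Zagier 2001 §1.2;
Bolsinov–Fomenko 2004 §13.3.2 (sphero-conical coordinates); Archimedes, On the Sphere and Cylinder I.
-/

noncomputable section

namespace Summit.KontsevichZagierPeriods.UnfoldedStokes.LegendreCubicFormLine

open Set MeasureTheory
open Literature.NumberTheory.Transcendental

/-- Injectivity of the hat-box map `Λ(λ,μ) = (u,z)` (tangent of the azimuth and height of the sphero-conal point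
of `S²` with confocal coordinates `(λ,μ)`) on the open period rectangle `(e₁,e₂) × (e₂,e₃)`: the squares
`x₁² = (1−z²)/(1+u²)`, `x₂² = u²x₁²`, `x₃² = z²` determine `λ+μ` and `λμ` (Vieta), hence `λ < μ`. [folklore] -/
theorem stub_hatBoxInjOn :
    ∀ (e₁ e₂ e₃ : ℚ), e₁ < e₂ → e₂ < e₃ → 
      Set.InjOn (fun x : Fin 2 → ℝ => (![Real.sqrt (((e₃ : ℝ) - (e₁ : ℝ)) * ((e₂ : ℝ) - x 0) * (x 1 - (e₂ : ℝ)) / (((e₃ : ℝ) - (e₂ : ℝ)) * (x 0 - (e₁ : ℝ)) * (x 1 - (e₁ : ℝ)))), Real.sqrt (((e₃ : ℝ) - x 0) * ((e₃ : ℝ) - x 1) / (((e₃ : ℝ) - (e₁ : ℝ)) * ((e₃ : ℝ) - (e₂ : ℝ))))] : Fin 2 → ℝ))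
        {x : Fin 2 → ℝ | (e₁ : ℝ) < x 0 ∧ x 0 < (e₂ : ℝ) ∧ (e₂ : ℝ) < x 1 ∧ x 1 < (e₃ : ℝ)} := by
  sorry

/-- The hat-box map sends the open period rectangle ONTO the open half-strip `(0,∞) × (0,1)`: for `(u,z)` in the
half-strip, `λ < μ` are the two roots of `q(θ) = Σ xᵢ² ∏_{j≠i}(θ−eⱼ)` with `x₁² = (1−z²)/(1+u²)`, `x₂² = u²x₁²`,
`x₃² = z²`, located by `q(e₁) > 0 > q(e₂)`, `q(e₃) > 0`. [folklore] -/
theorem stub_hatBoxImage :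
    ∀ (e₁ e₂ e₃ : ℚ), e₁ < e₂ → e₂ < e₃ → 
      (fun x : Fin 2 → ℝ => (![Real.sqrt (((e₃ : ℝ) - (e₁ : ℝ)) * ((e₂ : ℝ) - x 0) * (x 1 - (e₂ : ℝ)) / (((e₃ : ℝ) - (e₂ : ℝ)) * (x 0 - (e₁ : ℝ)) * (x 1 - (e₁ : ℝ)))), Real.sqrt (((e₃ : ℝ) - x 0) * ((e₃ : ℝ) - x 1) / (((e₃ : ℝ) - (e₁ : ℝ)) * ((e₃ : ℝ) - (e₂ : ℝ))))] : Fin 2 → ℝ)) ''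
          {x : Fin 2 → ℝ | (e₁ : ℝ) < x 0 ∧ x 0 < (e₂ : ℝ) ∧ (e₂ : ℝ) < x 1 ∧ x 1 < (e₃ : ℝ)} =
        {w : Fin 2 → ℝ | 0 < w 0 ∧ 0 < w 1 ∧ w 1 < 1} := by
  sorry

/-- Differentiability of the hat-box map on the open rectangle together with the PULL-BACK IDENTITY
`g = (4/(1+u²)) · |det DΛ|` (Archimedes' hat-box: `g dλ dμ = 4 dA_{S²} = 4 dθ dz = 4 du dz/(1+u²)`; partials
`u_λ = −u(e₂−e₁)/(2(λ−e₁)(e₂−λ))`, `u_μ = u(e₂−e₁)/(2(μ−e₁)(μ−e₂))`, `z_λ = −z/(2(e₃−λ))`, `z_μ = −z/(2(e₃−μ))`,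
heart `(e₂−e₁)(D₃ − C²) = (e₃−e₂)(λ−e₁)(μ−e₁) + (e₂−λ)(μ−e₂)(e₃−e₁)`). [folklore] -/
theorem stub_hatBoxJacobian :
    ∀ (e₁ e₂ e₃ : ℚ), e₁ < e₂ → e₂ < e₃ → 
      ∀ x ∈ {x : Fin 2 → ℝ | (e₁ : ℝ) < x 0 ∧ x 0 < (e₂ : ℝ) ∧ (e₂ : ℝ) < x 1 ∧ x 1 < (e₃ : ℝ)},
        ∃ L : (Fin 2 → ℝ) →L[ℝ] (Fin 2 → ℝ),
          HasFDerivAt (fun x : Fin 2 → ℝ => (![Real.sqrt (((e₃ : ℝ) - (e₁ : ℝ)) * ((e₂ : ℝ) - x 0) * (x 1 - (e₂ : ℝ)) / (((e₃ : ℝ) - (e₂ : ℝ)) * (x 0 - (e₁ : ℝ)) * (x 1 - (e₁ : ℝ)))), Real.sqrt (((e₃ : ℝ) - x 0) * ((e₃ : ℝ) - x 1) / (((e₃ : ℝ) - (e₁ : ℝ)) * ((e₃ : ℝ) - (e₂ : ℝ))))] : Fin 2 → ℝ)) L x ∧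
            (x 1 - x 0) / Real.sqrt (|(x 0 - (e₁ : ℝ)) * (x 0 - (e₂ : ℝ)) * (x 0 - (e₃ : ℝ))| * |(x 1 - (e₁ : ℝ)) * (x 1 - (e₂ : ℝ)) * (x 1 - (e₃ : ℝ))|) =
              4 / (1 + (Real.sqrt (((e₃ : ℝ) - (e₁ : ℝ)) * ((e₂ : ℝ) - x 0) * (x 1 - (e₂ : ℝ)) / (((e₃ : ℝ) - (e₂ : ℝ)) * (x 0 - (e₁ : ℝ)) * (x 1 - (e₁ : ℝ))))) ^ 2) * |L.det| := by
  sorry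

/-- KZ packaging of the hat-box substitution: given injectivity, the image and the differentiability + pull-back
identity of `Λ` on the open rectangle `R`, the pinned crux representation `[R, g]` is ONE instance of
Kontsevich–Zagier's rule (2) away from the flat representation `[(0,∞)×(0,1), 4/(1+u²)]`, which EXISTS (the
half-strip and `4/(1+u²)` are `ℚ`-semialgebraic; integrability transported along `Λ`); `Λ` is a `ℚ`-semialgebraic
map (two square roots of rational functions with rational coefficients). [cite: KontsevichZagier2001, §1.2 rule (2)] -/
theorem stub_hatBoxTransfer :
    ∀ (e₁ e₂ e₃ : ℚ), e₁ < e₂ → e₂ < e₃ → 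
      Set.InjOn (fun x : Fin 2 → ℝ => (![Real.sqrt (((e₃ : ℝ) - (e₁ : ℝ)) * ((e₂ : ℝ) - x 0) * (x 1 - (e₂ : ℝ)) / (((e₃ : ℝ) - (e₂ : ℝ)) * (x 0 - (e₁ : ℝ)) * (x 1 - (e₁ : ℝ)))), Real.sqrt (((e₃ : ℝ) - x 0) * ((e₃ : ℝ) - x 1) / (((e₃ : ℝ) - (e₁ : ℝ)) * ((e₃ : ℝ) - (e₂ : ℝ))))] : Fin 2 → ℝ))
        {x : Fin 2 → ℝ | (e₁ : ℝ) < x 0 ∧ x 0 < (e₂ : ℝ) ∧ (e₂ : ℝ) < x 1 ∧ x 1 < (e₃ : ℝ)} →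
      (fun x : Fin 2 → ℝ => (![Real.sqrt (((e₃ : ℝ) - (e₁ : ℝ)) * ((e₂ : ℝ) - x 0) * (x 1 - (e₂ : ℝ)) / (((e₃ : ℝ) - (e₂ : ℝ)) * (x 0 - (e₁ : ℝ)) * (x 1 - (e₁ : ℝ)))), Real.sqrt (((e₃ : ℝ) - x 0) * ((e₃ : ℝ) - x 1) / (((e₃ : ℝ) - (e₁ : ℝ)) * ((e₃ : ℝ) - (e₂ : ℝ))))] : Fin 2 → ℝ)) ''
          {x : Fin 2 → ℝ | (e₁ : ℝ) < x 0 ∧ x 0 < (e₂ : ℝ) ∧ (e₂ : ℝ) < x 1 ∧ x 1 < (e₃ : ℝ)} =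
        {w : Fin 2 → ℝ | 0 < w 0 ∧ 0 < w 1 ∧ w 1 < 1} →
      (∀ x ∈ {x : Fin 2 → ℝ | (e₁ : ℝ) < x 0 ∧ x 0 < (e₂ : ℝ) ∧ (e₂ : ℝ) < x 1 ∧ x 1 < (e₃ : ℝ)}, ∃ L : (Fin 2 → ℝ) →L[ℝ] (Fin 2 → ℝ),
        HasFDerivAt (fun x : Fin 2 → ℝ => (![Real.sqrt (((e₃ : ℝ) - (e₁ : ℝ)) * ((e₂ : ℝ) - x 0) * (x 1 - (e₂ : ℝ)) / (((e₃ : ℝ) - (e₂ : ℝ)) * (x 0 - (e₁ : ℝ)) * (x 1 - (e₁ : ℝ)))), Real.sqrt (((e₃ : ℝ) - x 0) * ((e₃ : ℝ) - x 1) / (((e₃ : ℝ) - (e₁ : ℝ)) * ((e₃ : ℝ) - (e₂ : ℝ))))] : Fin 2 → ℝ)) L x ∧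
          (x 1 - x 0) / Real.sqrt (|(x 0 - (e₁ : ℝ)) * (x 0 - (e₂ : ℝ)) * (x 0 - (e₃ : ℝ))| * |(x 1 - (e₁ : ℝ)) * (x 1 - (e₂ : ℝ)) * (x 1 - (e₃ : ℝ))|) =
            4 / (1 + (Real.sqrt (((e₃ : ℝ) - (e₁ : ℝ)) * ((e₂ : ℝ) - x 0) * (x 1 - (e₂ : ℝ)) / (((e₃ : ℝ) - (e₂ : ℝ)) * (x 0 - (e₁ : ℝ)) * (x 1 - (e₁ : ℝ))))) ^ 2) * |L.det|) →
      ∀ (r : KZ.IntegralRep 2), r.domain = {x : Fin 2 → ℝ | (e₁ : ℝ) < x 0 ∧ x 0 < (e₂ : ℝ) ∧ (e₂ : ℝ) < x 1 ∧ x 1 < (e₃ : ℝ)} →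
        Set.EqOn r.integrand (fun x : Fin 2 → ℝ => (x 1 - x 0) / Real.sqrt (|(x 0 - (e₁ : ℝ)) * (x 0 - (e₂ : ℝ)) * (x 0 - (e₃ : ℝ))| * |(x 1 - (e₁ : ℝ)) * (x 1 - (e₂ : ℝ)) * (x 1 - (e₃ : ℝ))|)) r.domain →
        ∃ p : KZ.IntegralRep 2, p.domain = {w : Fin 2 → ℝ | 0 < w 0 ∧ 0 < w 1 ∧ w 1 < 1} ∧
          p.integrand = (fun w : Fin 2 → ℝ => 4 / (1 + w 0 ^ 2)) ∧ KZ.of r - KZ.of p ∈ KZ.changeOfVariablesRel := by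
  sorry

/-- HEIGHT INTEGRATION: the flat representation `[(0,∞)×(0,1), 4/(1+u²)]` is KZ-equivalent to `[(0,∞), 4/(1+u²)]`,
which EXISTS — null faces `z ∈ {0,1}` (rule 1 with a null set), then ONE Newton–Leibniz move along the last
coordinate over the base `(0,∞)` with `a ≡ 0 ≤ b ≡ 1` and the polynomial-in-`z` primitive `F(u,z) = 4z/(1+u²)`.
[cite: KontsevichZagier2001, §1.2 rule (3)] -/
theorem stub_heightNewtonLeibniz :
    ∀ (p : KZ.IntegralRep 2), p.domain = {w : Fin 2 → ℝ | 0 < w 0 ∧ 0 < w 1 ∧ w 1 < 1} →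
      Set.EqOn p.integrand (fun w : Fin 2 → ℝ => 4 / (1 + w 0 ^ 2)) p.domain →
      ∃ q : KZ.IntegralRep 1, q.domain = {x : Fin 1 → ℝ | 0 < x 0} ∧
        q.integrand = (fun x : Fin 1 → ℝ => 4 / (1 + x 0 ^ 2)) ∧ KZ.Equivalent p q := by
  sorry

/-- ARCTANGENT TAIL: `[(0,∞), 4/(1+x²)] ~ [ℝ, 2/(1+x²)]` — integrand additivity `4 = 2 + 2`, the reflection `x ↦ −x`
of one copy onto `(−∞,0)` (rule 2), and domain additivity `ℝ = (−∞,0) ∪ {0} ∪ (0,∞)` with the null point (rule 1).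
[cite: KontsevichZagier2001, §1.2] -/
theorem stub_arctanTail :
    ∀ (q r' : KZ.IntegralRep 1), q.domain = {x : Fin 1 → ℝ | 0 < x 0} →
      Set.EqOn q.integrand (fun x : Fin 1 → ℝ => 4 / (1 + x 0 ^ 2)) q.domain →
      r'.domain = Set.univ → Set.EqOn r'.integrand (fun x => 2 / (1 + x 0 ^ 2)) r'.domain →
      KZ.Equivalent q r' := by
  sorry

end Summit.KontsevichZagierPeriods.UnfoldedStokes.LegendreCubicFormLine

-- `Summit.<Summit>.<Sub>` with Sub = Summit (single-conjunct summit, D-0017) duplicates the segment.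
set_option linter.dupNamespace false

namespace Summit.KontsevichZagierPeriods.KontsevichZagierPeriods.Theorems

open Set MeasureTheory
open Literature.NumberTheory.Transcendental
open Summit.KontsevichZagierPeriods.UnfoldedStokes.LegendreCubicFormLine

/-- **Legendre's relation in single-curve interval form** (crux `LegendreCubicForm`, stmt-KontsevichZagierPeriods-3521):
for rational `e₁ < e₂ < e₃` the representation `[(e₁,e₂)×(e₂,e₃), (μ−λ)/√(|P(λ)||P(μ)|)]` is KZ-equivalent to
`[ℝ, 2/(1+x²)]` — one hat-box change of variables, one Newton–Leibniz move in the height, and the arctangent tail.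
[cite: KontsevichZagier2001, §1.2] -/
theorem LegendreCubicForm_of :
    Summit.KontsevichZagierPeriods.KontsevichZagierPeriods.Theses.UnfoldedStokes.LegendreCubicForm := by
  intro e₁ e₂ e₃ h12 h23 r r' hrd hri hr'd hr'i
  obtain ⟨p, hpd, hpi, hcov⟩ :=
    stub_hatBoxTransfer e₁ e₂ e₃ h12 h23 (stub_hatBoxInjOn e₁ e₂ e₃ h12 h23)
      (stub_hatBoxImage e₁ e₂ e₃ h12 h23) (stub_hatBoxJacobian e₁ e₂ e₃ h12 h23) r hrd hri
  have hrp : KZ.Equivalent r p := KZ.changeOfVariablesRel_subset_relations hcov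
  obtain ⟨q, hqd, hqi, hpq⟩ := stub_heightNewtonLeibniz p hpd (by rw [hpi]; exact fun _ _ => rfl)
  have hqr' : KZ.Equivalent q r' := stub_arctanTail q r' hqd (by rw [hqi]; exact fun _ _ => rfl) hr'd hr'i
  exact (hrp.trans hpq).trans hqr'

end Summit.KontsevichZagierPeriods.KontsevichZagierPeriods.Theorems
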